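import Summits.HubbardSuperconductivity.HubbardSuperconductivity.Theorems.AnisotropyChordTowerCounting

/-!
# Route `AnisotropyChord` / H0 rotor rung: THE TRANSPOSITION FORM (III): regular ⇒ lowest weight, connectivity ⇒ sector functions
(port of theory seat `hubbard-h0-rotor-theory-1`, cycle 11, Sketch11 Part H; work-order v12b; director CYCLE-12 ruling (A); linters
`unusedSectionVars`/`unusedVariables` disabled as in the theory seat's file).  Typing/proof authority: theory seat.  Part H summary:

## Part H — THE TRANSPOSITION FORM OF `H_FM − e₀`, PERMUTATION EQUIVARIANCE OF THE TOWER, THE SUBSET-SUM FORMULA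
AND THE COUNTING IDENTITY ON REGULAR GRAPHS (memo §156 (L1)+(L3), §157(b); port spec P-12 item v12b)

`A := fmOp G` is `H_FM − e₀ = ½ Σ_{edges} (1 − T_xy)` acting on amplitudes by edge transpositions: a sum of squares
(`inner_fmOp_eq`, hence `⪰ 0`), killing every function of the particle number (`fmOp_sectorFun`), with
`⟨b, A b⟩ = 0 ⇒ b` edge-transposition invariant (`swapInvariant_of_inner_fmOp_eq_zero`; on a connected graph this is
"constant on sectors" — the connectivity step is left to the port), and commuting with `S⁺_tot` (`raiseSum_fmOp`).
`raiseIter_eq_subsetSum` writes the tower `(S⁺)^k f` as `k!`× a sum over sub-configurations; with the degree count and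
`isingW_eq` it gives the COUNTING IDENTITY `raiseIter_edgeMinusMean` (= the one-magnon closure `W φ₀ = w₀ φ₀ + (S⁺)^{n−2} u /((n−2)! N_n)`)
and `lowerSum_edgeMinusMean` (regular ⇒ `u` is a lowest-weight two-magnon vector), i.e. the inputs (L1), (L3) of THEOREM P′.
-/

set_option linter.dupNamespace false
set_option linter.unusedSectionVars false
set_option linter.unusedVariables false
set_option autoImplicit false

noncomputable section

open Finset Filter Topology
open Summit.HubbardSuperconductivity.HubbardSuperconductivity.Theorems.AnisotropyChord.InsertionEntropy
open Literature.MathematicalPhysics.QuantumLattice Literature.Probability.LatticeModels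

namespace Summit.HubbardSuperconductivity.HubbardSuperconductivity.Theorems.AnisotropyChord.Tower

section Transposition

variable {V : Type} [Fintype V] [DecidableEq V]

variable (G : SimpleGraph V) [DecidableRel G.Adj]

/-- Every element of `Fin 2` is `0` or `1`. [folklore] -/
private theorem fin2_cases' (i : Fin 2) : i = 0 ∨ i = 1 := by
  rcases i with ⟨_ | _ | k, hk⟩
  · left; rfl
  · right; rfl
  · omega

/-- **regularity ⇔ lowest weight**: on a `d`-regular graph with `κ (|V| − 1) = d` (i.e. `κ = |E|/C(|V|,2)`),
`S⁻_tot u = 0`. -/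
theorem lowerSum_edgeMinusMean (d : ℕ) (κ : ℝ)
    (hreg : ∀ x : V, (∑ y, if G.Adj x y then (1:ℝ) else 0) = d)
    (hκ : κ * ((Fintype.card V : ℝ) - 1) = d) :
    lowerSum (edgeMinusMean G κ) = fun _ => 0 := by
  funext τ
  unfold lowerSum
  by_cases hτ : zerosCard τ = 1
  · -- τ has exactly one particle z; adding a particle at x ≠ z gives the pair {z, x}
    have hval : ∀ x, (if τ x = 1 then edgeMinusMean G κ (Function.update τ x 0) else 0)
        = if τ x = 1 then ((∑ y, if G.Adj x y ∧ τ y = 0 then (1:ℝ) else 0) - κ) else 0 := by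
      intro x
      by_cases hx : τ x = 1
      · simp only [hx, if_true]
        unfold edgeMinusMean
        have hz2 : zerosCard (Function.update τ x 0) = 2 := by
          have h0 : (Function.update τ x 0) x = 0 := by simp
          have := zerosCard_update_one h0
          have hu : Function.update τ x (1 : Fin 2) = τ := Function.update_eq_self_iff.mpr hx.symm
          rw [Function.update_idem, hu] at this
          rw [this, hτ]; norm_num
        rw [if_pos hz2]
        congr 1
        -- ½ insideOrd (τ + particle at x) = #{y ∼ x : τ y = 0}
        unfold insideOrd
        have hone : ∃ z, τ z = 0 ∧ ∀ w, τ w = 0 → w = z := by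
          have hc : (univ.filter fun w => τ w = 0).card = 1 := by
            unfold zerosCard at hτ; exact_mod_cast hτ
          obtain ⟨z, hz⟩ := Finset.card_eq_one.mp hc
          refine ⟨z, ?_, ?_⟩
          · have : z ∈ univ.filter fun w => τ w = 0 := by rw [hz]; simp
            simpa using this
          · intro w hw
            have : w ∈ univ.filter fun w => τ w = 0 := by simp [hw]
            rw [hz] at this; simpa using this
        obtain ⟨z, hz0, hzu⟩ := hone
        have hxz : x ≠ z := by intro h; rw [h, hz0] at hx; exact absurd hx (by decide)
        -- evaluate the double sum: only (x,z) and (z,x) contribute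
        have hupd : ∀ w, Function.update τ x 0 w = 0 ↔ (w = x ∨ w = z) := by
          intro w
          by_cases hw : w = x
          · subst hw; simp
          · rw [Function.update_of_ne hw]
            constructor
            · intro h; right; exact hzu w h
            · rintro (h | h); · exact absurd h hw
              · rw [h]; exact hz0
        have hrow : ∀ a, (∑ b, if G.Adj a b ∧ Function.update τ x 0 a = 0 ∧ Function.update τ x 0 b = 0
            then (1:ℝ) else 0) = if (a = x ∨ a = z) then (∑ b, if G.Adj a b ∧ (b = x ∨ b = z) then (1:ℝ) else 0) else 0 := by
          intro a
          by_cases ha : (a = x ∨ a = z)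
          · simp only [ha, if_true]
            refine Finset.sum_congr rfl fun b _ => ?_
            simp only [hupd]
            simp [ha]
          · simp only [ha, if_false]
            apply Finset.sum_eq_zero; intro b _
            rw [if_neg]; rintro ⟨_, ha', _⟩; exact ha ((hupd a).mp ha')
        simp_rw [hrow]
        rw [← Finset.sum_filter]
        have hfx : (univ.filter fun a : V => a = x ∨ a = z) = {x, z} := by
          ext a; simp [Finset.mem_insert, Finset.mem_singleton]
        rw [hfx, Finset.sum_pair hxz]
        have hin : ∀ a, (∑ b, if G.Adj a b ∧ (b = x ∨ b = z) then (1:ℝ) else 0)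
            = (if G.Adj a x then (1:ℝ) else 0) + (if G.Adj a z then (1:ℝ) else 0) := by
          intro a
          rw [← Finset.sum_filter]
          have : (univ.filter fun b : V => G.Adj a b ∧ (b = x ∨ b = z))
              = ({x, z} : Finset V).filter (fun b => G.Adj a b) := by
            ext b; simp [Finset.mem_filter, Finset.mem_insert, Finset.mem_singleton, and_comm]
          rw [this, Finset.sum_filter, Finset.sum_pair hxz]
        rw [hin, hin]
        have hxx : ¬ G.Adj x x := G.irrefl
        have hzz : ¬ G.Adj z z := G.irrefl
        have hsy : (if G.Adj z x then (1:ℝ) else 0) = if G.Adj x z then 1 else 0 := by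
          simp only [G.adj_comm]
        simp only [hxx, hzz, if_false, hsy]
        -- RHS: Σ_y [x ∼ y ∧ τ y = 0] = [x ∼ z]
        have : (∑ y, if G.Adj x y ∧ τ y = 0 then (1:ℝ) else 0) = if G.Adj x z then 1 else 0 := by
          rw [← Finset.sum_filter]
          have : (univ.filter fun y : V => G.Adj x y ∧ τ y = 0) = ({z} : Finset V).filter (fun y => G.Adj x y) := by
            ext y; simp only [Finset.mem_filter, Finset.mem_univ, true_and, Finset.mem_singleton]
            constructor
            · rintro ⟨h1, h2⟩; exact ⟨hzu y h2, h1⟩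
            · rintro ⟨rfl, h1⟩; exact ⟨h1, hz0⟩
          rw [this, Finset.sum_filter, Finset.sum_singleton]
        rw [this]; ring
      · simp [hx]
    simp_rw [hval]
    -- Σ_{x : τ x = 1} (#{y ∼ x : τ y = 0} − κ) = (Σ_x [τ x = 1] #{y∼x, τ y = 0}) − κ (|V| − 1) = d_z − d = 0
    obtain ⟨z, hz0, hzu⟩ : ∃ z, τ z = 0 ∧ ∀ w, τ w = 0 → w = z := by
      have hc : (univ.filter fun w => τ w = 0).card = 1 := by
        unfold zerosCard at hτ; exact_mod_cast hτ
      obtain ⟨z, hz⟩ := Finset.card_eq_one.mp hc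
      refine ⟨z, ?_, ?_⟩
      · have : z ∈ univ.filter fun w => τ w = 0 := by rw [hz]; simp
        simpa using this
      · intro w hw
        have : w ∈ univ.filter fun w => τ w = 0 := by simp [hw]
        rw [hz] at this; simpa using this
    have h1 : ∀ x, (τ x = 1) ↔ x ≠ z := by
      intro x; constructor
      · intro h hxz; rw [hxz, hz0] at h; exact absurd h (by decide)
      · intro h; rcases fin2_cases' (τ x) with q | q
        · exact absurd (hzu x q) h
        · exact q
    have hterm : ∀ x, (if τ x = 1 then ((∑ y, if G.Adj x y ∧ τ y = 0 then (1:ℝ) else 0) - κ) else 0)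
        = (if G.Adj z x then (1:ℝ) else 0) - (if x ≠ z then κ else 0) := by
      intro x
      by_cases hx : x = z
      · subst hx; simp [hz0]
      · have hx1 : τ x = 1 := (h1 x).mpr hx
        simp only [hx1, if_true, hx, ne_eq, not_false_eq_true]
        congr 1
        rw [← Finset.sum_filter]
        have : (univ.filter fun y : V => G.Adj x y ∧ τ y = 0) = ({z} : Finset V).filter (fun y => G.Adj x y) := by
          ext y; simp only [Finset.mem_filter, Finset.mem_univ, true_and, Finset.mem_singleton]
          constructor
          · rintro ⟨q1, q2⟩; exact ⟨hzu y q2, q1⟩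
          · rintro ⟨rfl, q1⟩; exact ⟨q1, hz0⟩
        rw [this, Finset.sum_filter, Finset.sum_singleton]; simp only [G.adj_comm]
    simp_rw [hterm]
    rw [Finset.sum_sub_distrib, hreg z]
    have : (∑ x, if x ≠ z then κ else (0:ℝ)) = κ * ((Fintype.card V : ℝ) - 1) := by
      rw [← Finset.sum_filter, Finset.sum_const, nsmul_eq_mul]
      have : (univ.filter fun x : V => x ≠ z) = univ.erase z := by ext x; simp
      rw [this, Finset.card_erase_of_mem (Finset.mem_univ z), Finset.card_univ]
      have hpos : 1 ≤ Fintype.card V := Fintype.card_pos_iff.mpr ⟨z⟩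
      push_cast [Nat.cast_sub hpos]; ring
    rw [this, hκ]; ring
  · -- τ not in the one-particle sector: every term vanishes by support
    apply Finset.sum_eq_zero; intro x _
    by_cases hx : τ x = 1
    · simp only [hx, if_true]
      unfold edgeMinusMean
      rw [if_neg]
      intro h2
      have h0 : (Function.update τ x 0) x = 0 := by simp
      have := zerosCard_update_one h0
      have hu : Function.update τ x (1 : Fin 2) = τ := Function.update_eq_self_iff.mpr hx.symm
      rw [Function.update_idem, hu, h2] at this
      exact hτ (by linarith)
    · simp [hx]


/-- Configurations with the same occupied set are equal. [folklore] -/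
theorem eq_of_zeroSet_eq {σ σ' : V → Fin 2} (h : zeroSet σ = zeroSet σ') : σ = σ' := by
  funext x
  have hx : σ x = 0 ↔ σ' x = 0 := by rw [← mem_zeroSet, ← mem_zeroSet, h]
  rcases fin2_cases' (σ x) with a | a <;> rcases fin2_cases' (σ' x) with c | c
  · rw [a, c]
  · exact absurd (hx.mp a) (by rw [c]; decide)
  · exact absurd (hx.mpr c) (by rw [a]; decide)
  · rw [a, c]

/-! ### H.5 connectivity (kernel of `A` on a connected graph): edge-transposition invariance ⇒ all-transposition invariance ⇒ constant on sectors -/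


/-- conjugating a transposition along an edge: `σ ∘ (x y) = ((σ ∘ (x v)) ∘ (v y)) ∘ (x v)` for `x ∉ {v, y}`… as
functions on configurations (all we need). -/
theorem comp_swap_conj (σ : V → Fin 2) {x v y : V} (hxv : x ≠ v) (hvy : v ≠ y) (hxy : x ≠ y) :
    σ ∘ ⇑(Equiv.swap x y) = ((σ ∘ ⇑(Equiv.swap x v)) ∘ ⇑(Equiv.swap v y)) ∘ ⇑(Equiv.swap x v) := by
  funext z
  simp only [Function.comp_apply, Equiv.swap_apply_def]
  by_cases h1 : z = x
  · subst h1; simp [hxy.symm, hvy.symm]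
  · by_cases h2 : z = y
    · subst h2; simp [h1, hxv.symm, hvy.symm]
    · by_cases h3 : z = v
      · subst h3; simp [h1, h2, hxv, hxy]
      · simp [h1, h2, h3]

/-- **edge transpositions suffice**: on a connected graph, an amplitude invariant under every EDGE transposition
is invariant under every transposition. -/
theorem swapInvariant_all_of_edges (hconn : G.Connected) (b : (V → Fin 2) → ℝ)
    (h : ∀ x y, G.Adj x y → ∀ σ, b (σ ∘ ⇑(Equiv.swap x y)) = b σ) :
    ∀ x y σ, b (σ ∘ ⇑(Equiv.swap x y)) = b σ := by
  -- along a walk from x to y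
  have key : ∀ (x y : V) (p : G.Walk x y) (σ : V → Fin 2), b (σ ∘ ⇑(Equiv.swap x y)) = b σ := by
    intro x y p
    induction p with
    | nil =>
        intro σ
        simp [Equiv.swap_self]
    | @cons u v w hadj p ih =>
        intro σ
        by_cases huw : u = w
        · subst huw; simp [Equiv.swap_self]
        · by_cases hvw : v = w
          · subst hvw; exact h u v hadj σ
          · have huv : u ≠ v := G.ne_of_adj hadj
            rw [comp_swap_conj σ huv hvw huw, h u v hadj, ih, h u v hadj]
  intro x y σ
  exact key x y (hconn.preconnected x y).some σ

/-- zero set after a transposition moving a particle from `x` to the hole `y`. -/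
theorem zeroSet_comp_swap {σ : V → Fin 2} {x y : V} (hx : σ x = 0) (hy : σ y = 1) :
    zeroSet (σ ∘ ⇑(Equiv.swap x y)) = insert y ((zeroSet σ).erase x) := by
  have hxy : x ≠ y := by intro h; rw [h, hy] at hx; exact absurd hx (by decide)
  ext z
  simp only [zeroSet, Finset.mem_filter, Finset.mem_univ, true_and, Function.comp_apply,
    Finset.mem_insert, Finset.mem_erase, Equiv.swap_apply_def]
  by_cases h1 : z = x
  · subst h1; simp [hxy, hy]
  · by_cases h2 : z = y
    · subst h2; simp [Ne.symm hxy, hx]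
    · simp [h1, h2]

/-- **constant on sectors**: an amplitude invariant under all transpositions depends only on the particle number. -/
theorem const_on_sector_of_swapInvariant (b : (V → Fin 2) → ℝ)
    (h : ∀ x y σ, b (σ ∘ ⇑(Equiv.swap x y)) = b σ) :
    ∀ σ σ' : V → Fin 2, zerosCard σ = zerosCard σ' → b σ = b σ' := by
  -- induction on the number of particles of σ outside the particle set of σ'
  suffices H : ∀ (d : ℕ) (σ σ' : V → Fin 2), ((zeroSet σ) \ (zeroSet σ')).card = d →
      (zeroSet σ).card = (zeroSet σ').card → b σ = b σ' by
    intro σ σ' hc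
    have hc' : (zeroSet σ).card = (zeroSet σ').card := by
      rw [zerosCard_eq_card, zerosCard_eq_card] at hc; exact_mod_cast hc
    exact H _ σ σ' rfl hc'
  intro d
  induction d with
  | zero =>
      intro σ σ' hd hc
      have hsub : zeroSet σ ⊆ zeroSet σ' := by
        rw [Finset.card_eq_zero, Finset.sdiff_eq_empty_iff_subset] at hd; exact hd
      have heq : zeroSet σ = zeroSet σ' := Finset.eq_of_subset_of_card_le hsub (by rw [hc])
      rw [eq_of_zeroSet_eq heq]
  | succ d ih =>
      intro σ σ' hd hc
      -- pick x ∈ Z \ Z' and y ∈ Z' \ Z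
      have hne : ((zeroSet σ) \ (zeroSet σ')).Nonempty := by
        rw [← Finset.card_pos, hd]; exact Nat.succ_pos d
      obtain ⟨x, hx⟩ := hne
      have hcard' : ((zeroSet σ') \ (zeroSet σ)).card = d + 1 := by
        have h1 := Finset.card_sdiff_add_card_inter (zeroSet σ) (zeroSet σ')
        have h2 := Finset.card_sdiff_add_card_inter (zeroSet σ') (zeroSet σ)
        rw [Finset.inter_comm] at h2
        omega
      have hne' : ((zeroSet σ') \ (zeroSet σ)).Nonempty := by
        rw [← Finset.card_pos, hcard']; exact Nat.succ_pos d
      obtain ⟨y, hy⟩ := hne'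
      rw [Finset.mem_sdiff, mem_zeroSet, mem_zeroSet] at hx hy
      have hx0 : σ x = 0 := hx.1
      have hy1 : σ y = 1 := (fin2_cases' (σ y)).resolve_left hy.2
      have hxy : x ≠ y := by intro e; rw [e] at hx0; exact hy.2 hx0
      -- move the particle from x to y
      let τ := σ ∘ ⇑(Equiv.swap x y)
      have hτ : zeroSet τ = insert y ((zeroSet σ).erase x) := zeroSet_comp_swap hx0 hy1
      have hbτ : b τ = b σ := h x y σ
      have hyZ : y ∉ (zeroSet σ).erase x := by
        rw [Finset.mem_erase, mem_zeroSet]; exact fun q => hy.2 q.2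
      have hxZ : x ∈ zeroSet σ := mem_zeroSet.mpr hx0
      have hcτ : (zeroSet τ).card = (zeroSet σ').card := by
        rw [hτ, Finset.card_insert_of_notMem hyZ, Finset.card_erase_of_mem hxZ, ← hc]
        have : 1 ≤ (zeroSet σ).card := Finset.card_pos.mpr ⟨x, hxZ⟩
        omega
      have hdτ : ((zeroSet τ) \ (zeroSet σ')).card = d := by
        have hset : (zeroSet τ) \ (zeroSet σ') = ((zeroSet σ) \ (zeroSet σ')).erase x := by
          rw [hτ]; ext z
          simp only [Finset.mem_sdiff, Finset.mem_insert, Finset.mem_erase, mem_zeroSet]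
          constructor
          · rintro ⟨hz | ⟨hzx, hz0⟩, hz'⟩
            · exact absurd hy.1 (hz ▸ hz')
            · exact ⟨hzx, hz0, hz'⟩
          · rintro ⟨hzx, hz0, hz'⟩; exact ⟨Or.inr ⟨hzx, hz0⟩, hz'⟩
        rw [hset, Finset.card_erase_of_mem (by rw [Finset.mem_sdiff, mem_zeroSet, mem_zeroSet]; exact hx), hd]
        omega
      rw [← hbτ]
      exact ih τ σ' hdτ hcτ

/-- **kernel of the transposition form on a connected graph** (combine with `swapInvariant_of_inner_fmOp_eq_zero`):
edge-transposition invariance forces an amplitude to be a function of the particle number alone. -/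
theorem sectorFun_of_edgeSwapInvariant (hconn : G.Connected) (b : (V → Fin 2) → ℝ)
    (h : ∀ x y, G.Adj x y → ∀ σ, b (σ ∘ ⇑(Equiv.swap x y)) = b σ) :
    ∀ σ σ' : V → Fin 2, zerosCard σ = zerosCard σ' → b σ = b σ' :=
  const_on_sector_of_swapInvariant b (swapInvariant_all_of_edges G hconn b h)

end Transposition

end Summit.HubbardSuperconductivity.HubbardSuperconductivity.Theorems.AnisotropyChord.Tower
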